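import Mathlib
import HarnessLib.Audit
import Summits.PneNP.PneNP.Theorems.PstarGConstraint
import Summits.PneNP.PneNP.Theorems.PstarGapPeeling

/-!
# Folding an output with a private XOR slot into a G-constraint system (ROUND-24, preprocessing for `|W| ≥ 2`)

FRONTIER range-avoidance ladder, rung F-N3, ROUND 24 (cell `pnp-ideate`; restricted-model proof complexity — nothing here bears
on `P` versus `NP`).

The single-output, many-constraint form of the reader substitution (memo ROUND-24-PRESEED §13 R10(p)(b), plan v2 "step_fold",
and R10(q)(b) for `h` constraints): let `g ∈ J` have an XOR slot `t = I.vars g s` (`s ∈ {0,1}`) read by no other output of `J`,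
and let `t'` be its other XOR slot.  Substituting `x_t = x_{t'} + y_g + a_{p_g} a_{q_g}` into a G-constraint `(C, G, b)` with `g ∉ G`
gives `fold g (C, G, b) = (C △ {t,t'}, G ∪ {g}, b ⊕ y_g)` if `t ∈ C` and leaves it unchanged otherwise; then

* `gval_fold_iff_of_solves`: on a solution of `g`, the folded constraint holds iff the original does (`PstarGConstraint.gval_reader`);
* `solves_iff_fold`: `J` is solvable together with a system `𝒲` (all `G ∌ g`) iff `J ∖ {g}` is solvable together with the folded
  system — the folded system no longer reads `t` (typed instance), so a solution of the smaller problem is repaired at `t`.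

Together with `PstarReaderCore(System)` (all readers at once), `PstarGapFreeVar` / `PstarGSystemFreeVar` (free constraint
variables) this completes the formal preprocessing: a minimal infeasible pair may be assumed to have every constraint variable read,
no reader, and no private XOR slot in the core, at the price of monomial sets recording the folded outputs.
-/

set_option linter.dupNamespace false

open Finset Literature.Computability.Complexity
open scoped symmDiff
open Summit.PneNP.PneNP.Theorems.PstarPDT (parity)
open Summit.PneNP.PneNP.Theorems.PstarTyped (Typed)
open Summit.PneNP.PneNP.Theorems.PstarSALevel (varSet)
open Summit.PneNP.PneNP.Theorems.PstarGapPeeling (eval_update_of_not_mem eval_update_xor_slot)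
open Summit.PneNP.PneNP.Theorems.PstarFibrePolys (bit bit_xor bit_injective)
open Summit.PneNP.PneNP.Theorems.PstarGapOneAll (gval)
open Summit.PneNP.PneNP.Theorems.PstarGConstraint (bit_gval gval_reader bit_gval_update_xor)

namespace Summit.PneNP.PneNP.Theorems.PstarGSystemFold

variable {n m : ℕ}

/-- Folding output `g` into the constraint `w = (C, G, b)` through its XOR slots: if `C` contains the slot variable `t`, replace
`(C, G, b)` by `(C △ {t, t'}, G ∪ {g}, b ⊕ y_g)`; `t'` the other XOR slot.  (Symmetric in the two XOR slots.) -/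
def fold (I : LocalMap 4 n m) (y : Fin m → Bool) (g : Fin m) (t : Fin n) (w : Finset (Fin n) × Finset (Fin m) × Bool) :
    Finset (Fin n) × Finset (Fin m) × Bool :=
  if t ∈ w.1 then (w.1 ∆ {I.vars g 0, I.vars g 1}, insert g w.2.1, xor w.2.2 (y g)) else w

/-- A folded constraint does not contain the eliminated slot `t` in its linear part (when `t` is one of the two XOR slots). -/
theorem not_mem_fold (I : LocalMap 4 n m) (y : Fin m → Bool) (g : Fin m) {s : Fin 4} (hs : s.val < 2)
    (w : Finset (Fin n) × Finset (Fin m) × Bool) : I.vars g s ∉ (fold I y g (I.vars g s) w).1 := by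
  unfold fold
  split_ifs with h
  · have h01 : s = 0 ∨ s = 1 := by fin_cases s <;> simp at hs ⊢
    have hin : I.vars g s ∈ ({I.vars g 0, I.vars g 1} : Finset (Fin n)) := by
      rcases h01 with rfl | rfl <;> simp
    intro hmem
    rcases mem_symmDiff.1 hmem with ⟨-, h2⟩ | ⟨-, h2⟩
    · exact h2 hin
    · exact h2 h
  · exact h

/-- Monomials of a folded constraint: old monomials or `g`. -/
theorem mem_fold_monomials (I : LocalMap 4 n m) (y : Fin m → Bool) (g : Fin m) (t : Fin n) (w : Finset (Fin n) × Finset (Fin m) × Bool)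
    {g' : Fin m} (hg' : g' ∈ (fold I y g t w).2.1) : g' ∈ w.2.1 ∨ g' = g := by
  unfold fold at hg'
  split_ifs at hg'
  · rcases mem_insert.1 hg' with h | h
    · exact Or.inr h
    · exact Or.inl h
  · exact Or.inl hg'

/-- **On a solution of `g`** the folded constraint holds iff the original one does. -/
theorem gval_fold_iff_of_solves (I : LocalMap 4 n m) (hI : I.IsPure xorAndPred) (y : Fin m → Bool) {g : Fin m} (t : Fin n)
    (w : Finset (Fin n) × Finset (Fin m) × Bool) (hg : g ∉ w.2.1) {z : Fin n → Bool} (hz : I.eval z g = y g) :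
    gval I (fold I y g t w).1 (fold I y g t w).2.1 z = (fold I y g t w).2.2 ↔ gval I w.1 w.2.1 z = w.2.2 := by
  unfold fold
  split_ifs
  · simp only [gval_reader I hI w.1 hg z, hz]
    cases gval I w.1 w.2.1 z <;> cases w.2.2 <;> cases y g <;> simp
  · exact Iff.rfl

/-- The folded system, on solutions of `g`, is equivalent to the original system. -/
theorem gsat_fold_iff_of_solves (I : LocalMap 4 n m) (hI : I.IsPure xorAndPred) (y : Fin m → Bool) {g : Fin m} (t : Fin n)
    (𝒲 : Finset (Finset (Fin n) × Finset (Fin m) × Bool)) (h𝒲 : ∀ w ∈ 𝒲, g ∉ w.2.1) {z : Fin n → Bool} (hz : I.eval z g = y g) :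
    (∀ w ∈ 𝒲.image (fold I y g t), gval I w.1 w.2.1 z = w.2.2) ↔ ∀ w ∈ 𝒲, gval I w.1 w.2.1 z = w.2.2 := by
  classical
  constructor
  · intro h w hw
    exact (gval_fold_iff_of_solves I hI y t w (h𝒲 w hw) hz).1 (h _ (mem_image_of_mem _ hw))
  · intro h w' hw'
    obtain ⟨w, hw, rfl⟩ := mem_image.1 hw'
    exact (gval_fold_iff_of_solves I hI y t w (h𝒲 w hw) hz).2 (h w hw)

/-- **Folding an output with a private XOR slot.**  If the XOR slot `t = I.vars g s` of `g ∈ J` is read by no other output of `J`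
and `g` is a monomial of no constraint, then `J` is solvable with the system iff `J ∖ {g}` is solvable with the folded system. -/
theorem solves_iff_fold (I : LocalMap 4 n m) (hI : I.IsPure xorAndPred) (hT : Typed I) (y : Fin m → Bool) {J : Finset (Fin m)}
    {g : Fin m} (hg : g ∈ J) {s : Fin 4} (hs : s.val < 2) (hpriv : ∀ j ∈ J, j ≠ g → I.vars g s ∉ varSet I j)
    (𝒲 : Finset (Finset (Fin n) × Finset (Fin m) × Bool)) (h𝒲 : ∀ w ∈ 𝒲, g ∉ w.2.1) :
    (∃ z : Fin n → Bool, (∀ j ∈ J, I.eval z j = y j) ∧ ∀ w ∈ 𝒲, gval I w.1 w.2.1 z = w.2.2) ↔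
      ∃ z : Fin n → Bool, (∀ j ∈ J.erase g, I.eval z j = y j) ∧
        ∀ w ∈ 𝒲.image (fold I y g (I.vars g s)), gval I w.1 w.2.1 z = w.2.2 := by
  classical
  constructor
  · rintro ⟨z, hzJ, hz𝒲⟩
    exact ⟨z, fun j hj => hzJ j (mem_of_mem_erase hj), (gsat_fold_iff_of_solves I hI y (I.vars g s) 𝒲 h𝒲 (hzJ g hg)).2 hz𝒲⟩
  · rintro ⟨z, hzJ, hz𝒲⟩
    -- repair `g` at `t` if necessary; nothing else reads `t`
    by_cases hok : I.eval z g = y g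
    · exact ⟨z, fun j hj => if hjg : j = g then hjg ▸ hok else hzJ j (mem_erase.2 ⟨hjg, hj⟩),
        (gsat_fold_iff_of_solves I hI y (I.vars g s) 𝒲 h𝒲 hok).1 hz𝒲⟩
    · set z' := Function.update z (I.vars g s) (!z (I.vars g s)) with hz'
      have hg' : I.eval z' g = y g := by
        rw [hz', eval_update_xor_slot I hI z g s hs]
        revert hok
        cases I.eval z g <;> cases y g <;> simp
      have hJ' : ∀ j ∈ J, I.eval z' j = y j := by
        intro j hj
        by_cases hjg : j = g
        · exact hjg ▸ hg'
        · rw [hz', eval_update_of_not_mem I j z (hpriv j hj hjg)]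
          exact hzJ j (mem_erase.2 ⟨hjg, hj⟩)
      refine ⟨z', hJ', (gsat_fold_iff_of_solves I hI y (I.vars g s) 𝒲 h𝒲 hg').1 fun w' hw' => ?_⟩
      -- the folded system does not read `t`
      obtain ⟨w, -, rfl⟩ := mem_image.1 hw'
      have h1 := hz𝒲 _ hw'
      have hval : gval I (fold I y g (I.vars g s) w).1 (fold I y g (I.vars g s) w).2.1 z' =
          gval I (fold I y g (I.vars g s) w).1 (fold I y g (I.vars g s) w).2.1 z := by
        apply bit_injective
        rw [hz', bit_gval_update_xor I hT _ _ z hs, if_neg (not_mem_fold I y g hs w), add_zero]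
      rw [hval]
      exact h1

end Summit.PneNP.PneNP.Theorems.PstarGSystemFold
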